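import Literature.AlgebraicGeometry.ShimuraVarieties.UnitaryBallConeFormPullback
import HarnessLib

/-!
# Transport of the cone reading of forms along a uniformisation-compatible morphism (any ranks)

Topic `AlgebraicGeometry/ShimuraVarieties`; namespace
`Literature.AlgebraicGeometry.ShimuraVarieties.UnitaryBallUniformisationDatum` (datum-dotted). THEOREMS ONLY: no definition, no named
fact, no instance, no notation, no `sorry`; imports = tree only.

Two ball uniformisations read on their negative cones, `D : UnitaryBallUniformisationDatum p X` and
`D₁ : UnitaryBallUniformisationDatum p₁ Y`, Hodge models `A` of `X` and `A₁` of `Y` (so `ψ = (X^an ≃ X(ℂ))⁻¹ ∘ unif`,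
`ψ₁ = (Y^an ≃ Y(ℂ))⁻¹ ∘ unif₁`), a `ℂ`-morphism `φ : Y ⟶ X` and a complex `(p+1) × (p₁+1)` matrix `M` which INTERTWINES THE
UNIFORMISATIONS on the cone of `Y`: `φ(ℂ)(unif₁ y) = unif(M y)` for `y ∈ D₁.cone` (hypothesis `hcomp`, stated pointwise on complex points,
★ `Motives.AlgPoints.map`). Instances: a compatible special curve in a ball quotient surface (★ `IsCompatibleSpecialSource`, `M` the
`3 × 2` isometric embedding, [Liu2021] proof of Thm. 4.15 l. 2207); the Hecke ∕ transition morphisms between the pieces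
`Γ_q \ 𝔻`, `Γ_{q'} \ 𝔻` of a unitary Shimura curve (`p = p₁ = 1`, `M = σ(γ)` for `γ ∈ U(J)(F)`, [Milne2005ShimuraVarieties] §5 Def. 5.14,
§13 p. 118: `T(g)[x, aK] = [x, agK′]`); an automorphism of one quotient. We prove, generalising ★
`IsCompatibleSpecialSource.symm_comp_unif_mulVec` ∕ `….mform_apply_mfderiv_mulVec_eq_pullback` (`UnitaryBallConeFormPullback` §3,
`p = 2` over `p₁ = 1`) to any ranks and any `k`-form, with the structure hypothesis replaced by the one equation it uses:

* `symm_comp_unif_mulVec_of_map_unif_eq` — `ψ (M y) = φ^an (ψ₁ y)` (★ `HodgeModel.anMap`), from the single equation at `y`;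
* `mform_apply_mfderiv_mulVec_eq_pullback_of_map_unif_eq` — **the chain rule**: for a complex `k`-form `α` on `X^an`, `y ∈ D₁.cone`
  with `M y ∈ D.cone` and vectors `t₁, …, t_k ∈ ℂ^{p₁+1}`,
  `α_{ψ(M y)}(dψ_{M y}(M t₁), …, dψ_{M y}(M t_k)) = ((φ^an)^* α)_{ψ₁ y}(dψ₁,_y t₁, …, dψ₁,_y t_k)` (`ψ ∘ M = φ^an ∘ ψ₁` near `y`,
  `φ^an` holomorphic by GAGA ★ `HodgeModel.mdifferentiable_anMap`, chain rule for `mfderiv`; [VoisinHodgeI2002] §2.2.1, §7.3.2);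
* `pullback_coneDeriv_mulVec_eq` — **the cone reading in the group variable is transported by left multiplication by `M`**:
  `F_{(φ^an)^*α}(g) = F_α(M g)`, i.e. `((φ^an)^*α)_{ψ₁(g v₀)}(dψ₁(g t₁), …) = α_{ψ(M g v₀)}(dψ((M g) t₁), …)` for every
  `(p₁+1) × (p₁+1)` matrix `g` with `g v₀ ∈ D₁.cone`, `M g v₀ ∈ D.cone` — the identity behind «pull-back of cohomology classes along
  Hecke correspondences = right translation of the automorphic forms realising them» ([Milne2005ShimuraVarieties] §5 p. 57–58;
  [BorelJacquet1979] §4.3) once forms are read on the cone; `pullback_coneDeriv_mulVec_eq'` is the variant with `M` carrying the whole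
  cone of `Y` into the cone of `X`.

References: C. Voisin, *Hodge Theory and Complex Algebraic Geometry I* (2002), §2.2.1, §7.3.2; J.-P. Serre, GAGA (1956), §2 n°5;
J. S. Milne, *Introduction to Shimura varieties* (2005), §5 (p. 57–58, Def. 5.14), §13 (p. 118); A. Borel, H. Jacquet, Corvallis
PSPM 33.1 (1979), §4.3; Y. Liu (2021), proof of Thm. 4.15.
-/

noncomputable section

open Matrix Function Set Filter
open scoped Manifold Topology
open Literature.Geometry.ComplexHyperbolic
open Literature.Geometry.Kaehler (MForm)
open Literature.NumberTheory.Transcendental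
open Literature.AlgebraicGeometry.HodgeTheory (HodgeModel)

namespace Literature.AlgebraicGeometry.ShimuraVarieties

namespace UnitaryBallUniformisationDatum

variable {p p₁ : ℕ} {X Y : Motives.SchemeOver ℂ} (D : UnitaryBallUniformisationDatum p X) (A : HodgeModel p X)
  (D₁ : UnitaryBallUniformisationDatum p₁ Y) (A₁ : HodgeModel p₁ Y) {φ : Y ⟶ X}
  {M : Matrix (Fin (p + 1)) (Fin (p₁ + 1)) ℂ}

/-! ### §1 The two uniformisations read in the Hodge models -/

/-- **`ψ (M y) = φ^an (ψ₁ y)`** as soon as `φ(ℂ)(unif₁ y) = unif(M y)`: both sides lie over the same complex point of `X`.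
[cite: SerreGAGA1956, §2 n°5 (fonctorialité de X^h)] -/
theorem symm_comp_unif_mulVec_of_map_unif_eq {y : Fin (p₁ + 1) → ℂ}
    (hcomp : Motives.AlgPoints.map φ (D₁.unif y) = D.unif (M *ᵥ y)) :
    (⇑A.isAnalytification.homeomorph.symm ∘ D.unif) (M *ᵥ y) =
      HodgeModel.anMap A A₁ φ ((⇑A₁.isAnalytification.homeomorph.symm ∘ D₁.unif) y) := by
  apply A.isAnalytification.homeomorph.injective
  change A.toComplexPoints _ = A.toComplexPoints _
  rw [toComplexPoints_symm_comp_unif, HodgeModel.toComplexPoints_anMap, toComplexPoints_symm_comp_unif]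
  exact hcomp.symm

/-! ### §2 The chain rule along `ψ ∘ M = φ^an ∘ ψ₁` -/

/-- **The chain rule along a uniformisation-compatible morphism** (any ranks, any degree): if `φ(ℂ)(unif₁ y') = unif(M y')` on the
cone of `Y`, then for a complex `k`-form `α` on `X^an`, a cone point `y` of `Y` with `M y` in the cone of `X` and vectors
`t₁, …, t_k ∈ ℂ^{p₁+1}`: `α_{ψ(M y)}(dψ_{M y}(M t₁), …, dψ_{M y}(M t_k)) = ((φ^an)^* α)_{ψ₁ y}(dψ₁,_y t₁, …, dψ₁,_y t_k)` — `ψ ∘ M = φ^an ∘ ψ₁`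
near `y`, `φ^an` is holomorphic (GAGA) and `d(ψ ∘ M)_y = dψ_{M y} ∘ M`. [cite: VoisinHodgeI2002, §2.2.1 and §7.3.2] -/
theorem mform_apply_mfderiv_mulVec_eq_pullback_of_map_unif_eq {k : ℕ} (α : MForm 𝓘(ℝ, A.model) A.carrier ℂ k)
    (hcomp : ∀ y' ∈ D₁.cone, Motives.AlgPoints.map φ (D₁.unif y') = D.unif (M *ᵥ y'))
    {y : Fin (p₁ + 1) → ℂ} (hy : y ∈ D₁.cone) (hMy : M *ᵥ y ∈ D.cone) (t : Fin k → (Fin (p₁ + 1) → ℂ)) :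
    α ((⇑A.isAnalytification.homeomorph.symm ∘ D.unif) (M *ᵥ y))
        (fun i ↦ mfderiv 𝓘(ℝ, Fin (p + 1) → ℂ) 𝓘(ℝ, A.model) (⇑A.isAnalytification.homeomorph.symm ∘ D.unif)
          (M *ᵥ y) (M *ᵥ t i)) =
      (α.pullback 𝓘(ℝ, A₁.model) (HodgeModel.anMap A A₁ φ)) ((⇑A₁.isAnalytification.homeomorph.symm ∘ D₁.unif) y)
        (fun i ↦ mfderiv 𝓘(ℝ, Fin (p₁ + 1) → ℂ) 𝓘(ℝ, A₁.model) (⇑A₁.isAnalytification.homeomorph.symm ∘ D₁.unif) y (t i)) := by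
  -- notation-free abbreviations
  set ψ : (Fin (p + 1) → ℂ) → A.carrier := ⇑A.isAnalytification.homeomorph.symm ∘ D.unif with hψ
  set ψ₁ : (Fin (p₁ + 1) → ℂ) → A₁.carrier := ⇑A₁.isAnalytification.homeomorph.symm ∘ D₁.unif with hψ₁
  set fan : A₁.carrier → A.carrier := HodgeModel.anMap A A₁ φ with hfan
  -- the linear map `M` and its derivative
  let Mℝ : (Fin (p₁ + 1) → ℂ) →L[ℝ] (Fin (p + 1) → ℂ) :=
    (LinearMap.toContinuousLinearMap (Matrix.mulVecLin M)).restrictScalars ℝ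
  have hMderiv : HasMFDerivAt 𝓘(ℝ, Fin (p₁ + 1) → ℂ) 𝓘(ℝ, Fin (p + 1) → ℂ) (fun y' : Fin (p₁ + 1) → ℂ ↦ M *ᵥ y') y Mℝ :=
    hasMFDerivAt_iff_hasFDerivAt.2
      (((LinearMap.toContinuousLinearMap (Matrix.mulVecLin M)).hasFDerivAt).restrictScalars ℝ)
  -- the two composites agree near `y`
  have hEq : (ψ ∘ fun y' : Fin (p₁ + 1) → ℂ ↦ M *ᵥ y') =ᶠ[𝓝 y] (fan ∘ ψ₁) := by
    filter_upwards [(isOpen_negCone _).mem_nhds hy] with y' hy'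
    exact D.symm_comp_unif_mulVec_of_map_unif_eq A D₁ A₁ (hcomp y' hy')
  -- chain rules
  have hψd : HasMFDerivAt 𝓘(ℝ, Fin (p + 1) → ℂ) 𝓘(ℝ, A.model) ψ (M *ᵥ y)
      (mfderiv 𝓘(ℝ, Fin (p + 1) → ℂ) 𝓘(ℝ, A.model) ψ (M *ᵥ y)) :=
    (D.mdifferentiableAt_symm_comp_unif_real A hMy).hasMFDerivAt
  have hcomp₁ := (hψd.comp y hMderiv).mfderiv
  have hψ₁d : MDifferentiableAt 𝓘(ℝ, Fin (p₁ + 1) → ℂ) 𝓘(ℝ, A₁.model) ψ₁ y :=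
    D₁.mdifferentiableAt_symm_comp_unif_real A₁ hy
  have hfand : MDifferentiableAt 𝓘(ℝ, A₁.model) 𝓘(ℝ, A.model) fan (ψ₁ y) :=
    ((HodgeModel.mdifferentiable_anMap A A₁ φ D₁.isSmoothProjective D.isSmoothProjective) _).real_of_complex
  have hcomp₂ : mfderiv 𝓘(ℝ, Fin (p₁ + 1) → ℂ) 𝓘(ℝ, A.model) (fan ∘ ψ₁) y =
      (mfderiv 𝓘(ℝ, A₁.model) 𝓘(ℝ, A.model) fan (ψ₁ y)).comp
        (mfderiv 𝓘(ℝ, Fin (p₁ + 1) → ℂ) 𝓘(ℝ, A₁.model) ψ₁ y) :=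
    mfderiv_comp y hfand hψ₁d
  have hderiv : ∀ s : Fin (p₁ + 1) → ℂ, mfderiv 𝓘(ℝ, Fin (p + 1) → ℂ) 𝓘(ℝ, A.model) ψ (M *ᵥ y) (Mℝ s) =
      mfderiv 𝓘(ℝ, A₁.model) 𝓘(ℝ, A.model) fan (ψ₁ y)
        (mfderiv 𝓘(ℝ, Fin (p₁ + 1) → ℂ) 𝓘(ℝ, A₁.model) ψ₁ y s) := fun s ↦ by
    have h1 : mfderiv 𝓘(ℝ, Fin (p₁ + 1) → ℂ) 𝓘(ℝ, A.model) (ψ ∘ fun y' : Fin (p₁ + 1) → ℂ ↦ M *ᵥ y') y s =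
        mfderiv 𝓘(ℝ, Fin (p + 1) → ℂ) 𝓘(ℝ, A.model) ψ (M *ᵥ y) (Mℝ s) := by
      rw [hcomp₁]
      rfl
    rw [← h1, hEq.mfderiv_eq, hcomp₂]
    rfl
  -- evaluate the pulled-back form
  have hpt : ψ (M *ᵥ y) = fan (ψ₁ y) := D.symm_comp_unif_mulVec_of_map_unif_eq A D₁ A₁ (hcomp y hy)
  have hvec : (fun i ↦ mfderiv 𝓘(ℝ, Fin (p + 1) → ℂ) 𝓘(ℝ, A.model) ψ (M *ᵥ y) (M *ᵥ t i)) =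
      fun i ↦ mfderiv 𝓘(ℝ, A₁.model) 𝓘(ℝ, A.model) fan (ψ₁ y)
        (mfderiv 𝓘(ℝ, Fin (p₁ + 1) → ℂ) 𝓘(ℝ, A₁.model) ψ₁ y (t i)) := by
    funext i
    exact hderiv (t i)
  rw [MForm.pullback_apply, hvec]
  exact congrArg (fun x ↦ α x (fun i ↦ mfderiv 𝓘(ℝ, A₁.model) 𝓘(ℝ, A.model) fan (ψ₁ y)
    (mfderiv 𝓘(ℝ, Fin (p₁ + 1) → ℂ) 𝓘(ℝ, A₁.model) ψ₁ y (t i)))) hpt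

/-! ### §3 The cone reading in the group variable: `F_{(φ^an)^*α}(g) = F_α(M g)` -/

/-- **Transport of the cone reading in the group variable.** Under `φ(ℂ)(unif₁ y) = unif(M y)` on the cone of `Y`: for a `k`-form `α`
on `X^an`, vectors `v₀, t₁, …, t_k ∈ ℂ^{p₁+1}` and a matrix `g` with `g v₀ ∈ D₁.cone` and `M g v₀ ∈ D.cone`,
`((φ^an)^*α)_{ψ₁(g v₀)}(dψ₁,_{g v₀}(g t₁), …, dψ₁,_{g v₀}(g t_k)) = α_{ψ((M g) v₀)}(dψ_{(M g) v₀}((M g) t₁), …, dψ_{(M g) v₀}((M g) t_k))`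
— the cone function of the pulled-back form is the cone function of the form, read at `M g` (pull-back along a Hecke ∕ transition
morphism = translation of the realising function). [cite: Milne2005ShimuraVarieties, §5 p. 57–58 and §13 p. 118] -/
theorem pullback_coneDeriv_mulVec_eq {k : ℕ} (α : MForm 𝓘(ℝ, A.model) A.carrier ℂ k)
    (hcomp : ∀ y' ∈ D₁.cone, Motives.AlgPoints.map φ (D₁.unif y') = D.unif (M *ᵥ y'))
    (v₀ : Fin (p₁ + 1) → ℂ) (t : Fin k → (Fin (p₁ + 1) → ℂ)) {g : Matrix (Fin (p₁ + 1)) (Fin (p₁ + 1)) ℂ}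
    (hg : g *ᵥ v₀ ∈ D₁.cone) (hMg : (M * g) *ᵥ v₀ ∈ D.cone) :
    (α.pullback 𝓘(ℝ, A₁.model) (HodgeModel.anMap A A₁ φ)) ((⇑A₁.isAnalytification.homeomorph.symm ∘ D₁.unif) (g *ᵥ v₀))
        (fun i ↦ mfderiv 𝓘(ℝ, Fin (p₁ + 1) → ℂ) 𝓘(ℝ, A₁.model) (⇑A₁.isAnalytification.homeomorph.symm ∘ D₁.unif)
          (g *ᵥ v₀) (g *ᵥ t i)) =
      α ((⇑A.isAnalytification.homeomorph.symm ∘ D.unif) ((M * g) *ᵥ v₀))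
        (fun i ↦ mfderiv 𝓘(ℝ, Fin (p + 1) → ℂ) 𝓘(ℝ, A.model) (⇑A.isAnalytification.homeomorph.symm ∘ D.unif)
          ((M * g) *ᵥ v₀) ((M * g) *ᵥ t i)) := by
  have hMg' : M *ᵥ (g *ᵥ v₀) ∈ D.cone := by rwa [Matrix.mulVec_mulVec]
  have key := (D.mform_apply_mfderiv_mulVec_eq_pullback_of_map_unif_eq A D₁ A₁ α hcomp hg hMg' fun i ↦ g *ᵥ t i).symm
  rw [← Matrix.mulVec_mulVec]
  simp only [← Matrix.mulVec_mulVec]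
  exact key

/-- The same transport when `M` carries the whole cone of `Y` into the cone of `X` (e.g. `M` isometric, or `p = p₁` and `M` in the
unitary group of the form): `F_{(φ^an)^*α}(g) = F_α(M g)` at every `g` with `g v₀ ∈ D₁.cone`.
[cite: Milne2005ShimuraVarieties, §5 p. 57–58 and §13 p. 118] -/
theorem pullback_coneDeriv_mulVec_eq' {k : ℕ} (α : MForm 𝓘(ℝ, A.model) A.carrier ℂ k)
    (hcomp : ∀ y' ∈ D₁.cone, Motives.AlgPoints.map φ (D₁.unif y') = D.unif (M *ᵥ y'))
    (hM : ∀ y' ∈ D₁.cone, M *ᵥ y' ∈ D.cone)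
    (v₀ : Fin (p₁ + 1) → ℂ) (t : Fin k → (Fin (p₁ + 1) → ℂ)) {g : Matrix (Fin (p₁ + 1)) (Fin (p₁ + 1)) ℂ}
    (hg : g *ᵥ v₀ ∈ D₁.cone) :
    (α.pullback 𝓘(ℝ, A₁.model) (HodgeModel.anMap A A₁ φ)) ((⇑A₁.isAnalytification.homeomorph.symm ∘ D₁.unif) (g *ᵥ v₀))
        (fun i ↦ mfderiv 𝓘(ℝ, Fin (p₁ + 1) → ℂ) 𝓘(ℝ, A₁.model) (⇑A₁.isAnalytification.homeomorph.symm ∘ D₁.unif)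
          (g *ᵥ v₀) (g *ᵥ t i)) =
      α ((⇑A.isAnalytification.homeomorph.symm ∘ D.unif) ((M * g) *ᵥ v₀))
        (fun i ↦ mfderiv 𝓘(ℝ, Fin (p + 1) → ℂ) 𝓘(ℝ, A.model) (⇑A.isAnalytification.homeomorph.symm ∘ D.unif)
          ((M * g) *ᵥ v₀) ((M * g) *ᵥ t i)) :=
  D.pullback_coneDeriv_mulVec_eq A D₁ A₁ α hcomp v₀ t hg (by rw [← Matrix.mulVec_mulVec]; exact hM _ hg)

end UnitaryBallUniformisationDatum

end Literature.AlgebraicGeometry.ShimuraVarieties
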